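import Summits.ABC.ABC.Theses.IneffectiveSubspace
import Summits.ABC.ABC.Theorems.IneffectiveSubspaceUniformSadicGivesTowerFour
import Summits.ABC.ABC.Theorems.IneffectiveSubspaceUniformSadicTowerFourStubTowerOfMixedAt
import Summits.ABC.ABC.Theorems.IneffectiveSubspaceUniformSadicTowerFourStubMixedOfTowerAt

/-!
# `UniformSadicTowerFour` (stmt-ABC-14937), line `Sketch`: the mixed-radical NORMAL FORM of the crux

Three bookkeeping faces of the crux `UniformSadicTowerFour` ("Ridout at level four"), assembled from the
landed `S`-wise stubs `stub_tower_of_mixed_at` / `stub_mixed_of_tower_at` of the line `Sketch`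
(card `mixed-radical-exchange-map`):

* `stub_normalForm` — the crux is EQUIVALENT to its normal form on abc triples: for every
  `K`, `ε > 0` there is `C` with `c < C · M_S(abc)^(1+ε)` for every abc triple `(a, b, c)` and every set `S`
  of at most `K` primes, where the MIXED RADICAL `M_S(m) = (∏_{p ∈ S} p) · ∏_{p ∣ m, p ∉ S} p^⌈v_p(m)/4⌉`
  charges `p` on `S` and the 4-rounded radical off `S` (`⌈v/4⌉ = (v+3)/4`; everything inlined, no defs).
  In particular the line's open stub `stub_core` (= `∀ K, Mixed K`) IS the crux.
* `stub_cruxZero_iff_levelFour` — the `K = 0` face of the normal form is Vojta's inequality with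
  exponent `1` on the level-4 tower `X_4` (`TowerIneqAt 4 1`, inlined), and
  `towerIneqFourOne_of_uniformSadicTowerFour` — the crux implies it (the EXACT `K = 0` face; the landed
  `uniformSadicGivesTowerFour_proof` records only the weaker `∃ A < 2`).
* `stub_levelOneRung_of_mixed` / `levelOneRung_of_uniformSadicTowerFour` — the crux at budget `K` implies the
  LEVEL-ONE RUNG at budget `K` ("uniform Mahler–Ridout with linear `S`-loss": the `S`-free part `{abc}^S`
  in place of the rounded radical off `S`), because `p^⌈v/4⌉ ≤ p^v`.

Sources: card `mixed-radical-exchange-map` (crux stmt-ABC-14937, line `Sketch`), items `NormalForm`,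
`CruxZeroIsLevelFour`, `CruxGivesLevelOne` of `Cruxes/UniformSadicTowerFour/SketchIdeator1.lean`; Vojta 2000 §3.1
for the optimal lifts (inside the imported stubs). Deliberately NOT here: any claim about `stub_core` itself
(open, abc-strength), the `K`-uniform sandwich (`stub_uniformInK_iff_abc`) and places→level
(`stub_placesToLevel`), which are separate landed files.
-/

noncomputable section

-- `Summit.<Summit>.<Problem>` is the mandated summit-side namespace (CONVENTIONS §2); for the
-- single-conjunct summit `ABC` the two coincide, so the duplicate `ABC.ABC` is deliberate.
set_option linter.dupNamespace false

namespace Summit.ABC.ABC.Theorems.UniformSadicTowerFour.MixedRadical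

open Literature.NumberTheory.DiophantineGeometry (IsABCTriple rad rad_def)
open Summit.ABC.ABC.Theses.IneffectiveSubspace
open scoped BigOperators

/-- **Normal form of the crux.** `UniformSadicTowerFour` holds iff for every `K`, `ε > 0` there is `C`
with `c < C · ((∏_{p∈S} p) · ∏_{p ∣ abc, p ∉ S} p^⌈v_p(abc)/4⌉)^(1+ε)` for every abc triple and every set
`S` of at most `K` primes (same constants both ways: `→` optimal lifts, `stub_mixed_of_tower_at`;
`←` `⌈v_p(abc)/4⌉ ≤ v_p(∏ xᵢyᵢzᵢ)`, `stub_tower_of_mixed_at`). [folklore] -/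
theorem stub_normalForm :
    UniformSadicTowerFour ↔
      ∀ K : ℕ, ∀ ε : ℝ, 0 < ε → ∃ C : ℝ, 0 < C ∧ ∀ S : Finset ℕ, S.card ≤ K → (∀ p ∈ S, Nat.Prime p) →
        ∀ a b c : ℕ, IsABCTriple a b c →
          (c : ℝ) < C * ((((∏ p ∈ S, p) *
            ∏ p ∈ (a * b * c).primeFactors \ S, p ^ (((a * b * c).factorization p + 3) / 4) : ℕ) : ℝ)) ^
              (1 + ε) := by
  unfold UniformSadicTowerFour
  constructor
  · intro hU K ε hε
    obtain ⟨C, hC, hT⟩ := hU K ε hε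
    exact ⟨C, hC, fun S hcard hS a b c habc =>
      stub_mixed_of_tower_at (fun x y z hpos hsum hcop => hT S hcard hS x y z hpos hsum hcop)
        a b c habc⟩
  · intro hM K ε hε
    obtain ⟨C, hC, hK⟩ := hM K ε hε
    exact ⟨C, hC, fun S hcard hS x y z hpos hsum hcop =>
      stub_tower_of_mixed_at hC hε (fun a b c habc => hK S hcard hS a b c habc) x y z hpos hsum hcop⟩

/-- **The `K = 0` face is Vojta exponent 1 on `X_4`.** The normal form at budget `K = 0` (only `S = ∅`:
`c < C · (∏_{p ∣ abc} p^⌈v_p(abc)/4⌉)^(1+ε)`, abc with the 4-ROUNDED radical) is equivalent to the level-4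
tower inequality with exponent `1`: `∏ zᵢ^(i+1) < C · (∏ xᵢyᵢzᵢ)^(1+ε)` for every positive coprime point of
`X_4` (same constants; the `S = ∅` bracket of the crux is `∏ xᵢyᵢzᵢ` itself,
`UniformSadicGivesTowerFour.bracket_empty`). [folklore] -/
theorem stub_cruxZero_iff_levelFour :
    (∀ ε : ℝ, 0 < ε → ∃ C : ℝ, 0 < C ∧ ∀ S : Finset ℕ, S.card ≤ 0 → (∀ p ∈ S, Nat.Prime p) →
        ∀ a b c : ℕ, IsABCTriple a b c →
          (c : ℝ) < C * ((((∏ p ∈ S, p) *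
            ∏ p ∈ (a * b * c).primeFactors \ S, p ^ (((a * b * c).factorization p + 3) / 4) : ℕ) : ℝ)) ^
              (1 + ε)) ↔
      ∀ ε : ℝ, 0 < ε → ∃ C : ℝ, 0 < C ∧ ∀ x y z : Fin 4 → ℕ, (∀ i, 0 < x i ∧ 0 < y i ∧ 0 < z i) →
        (∏ i, x i ^ (i.val + 1)) + (∏ i, y i ^ (i.val + 1)) = ∏ i, z i ^ (i.val + 1) →
        Nat.Coprime (∏ i, x i ^ (i.val + 1)) (∏ i, y i ^ (i.val + 1)) →
        ((∏ i, z i ^ (i.val + 1) : ℕ) : ℝ) < C * ((∏ i, x i * y i * z i : ℕ) : ℝ) ^ (1 + ε) := by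
  constructor
  · intro hM ε hε
    obtain ⟨C, hC, hK⟩ := hM ε hε
    refine ⟨C, hC, fun x y z hpos hsum hcop => ?_⟩
    have hP : (∏ i, x i * y i * z i) ≠ 0 :=
      (Finset.prod_pos fun i _ =>
        Nat.mul_pos (Nat.mul_pos (hpos i).1 (hpos i).2.1) (hpos i).2.2).ne'
    have h := stub_tower_of_mixed_at hC hε
      (fun a b c habc => hK ∅ (by simp) (by simp) a b c habc) x y z hpos hsum hcop
    rwa [UniformSadicGivesTowerFour.bracket_empty hP] at h
  · intro hT ε hε
    obtain ⟨C, hC, hTow⟩ := hT ε hε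
    refine ⟨C, hC, fun S hcard _hS a b c habc => ?_⟩
    obtain rfl : S = ∅ := Finset.card_eq_zero.mp (Nat.le_zero.mp hcard)
    refine stub_mixed_of_tower_at (fun x y z hpos hsum hcop => ?_) a b c habc
    have hP : (∏ i, x i * y i * z i) ≠ 0 :=
      (Finset.prod_pos fun i _ =>
        Nat.mul_pos (Nat.mul_pos (hpos i).1 (hpos i).2.1) (hpos i).2.2).ne'
    rw [UniformSadicGivesTowerFour.bracket_empty hP]
    exact hTow x y z hpos hsum hcop

/-- **The crux implies Vojta exponent 1 on `X_4`** (its exact `K = 0` face): for every `ε > 0` there is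
`C` with `∏ zᵢ^(i+1) < C · (∏ xᵢyᵢzᵢ)^(1+ε)` for every positive coprime level-4 tower point. (The landed
`uniformSadicGivesTowerFour_proof` records the weaker corollary `TowerFourSubLiouville`, `∃ A < 2`.)
[folklore] -/
theorem towerIneqFourOne_of_uniformSadicTowerFour (hU : UniformSadicTowerFour) :
    ∀ ε : ℝ, 0 < ε → ∃ C : ℝ, 0 < C ∧ ∀ x y z : Fin 4 → ℕ, (∀ i, 0 < x i ∧ 0 < y i ∧ 0 < z i) →
      (∏ i, x i ^ (i.val + 1)) + (∏ i, y i ^ (i.val + 1)) = ∏ i, z i ^ (i.val + 1) →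
      Nat.Coprime (∏ i, x i ^ (i.val + 1)) (∏ i, y i ^ (i.val + 1)) →
      ((∏ i, z i ^ (i.val + 1) : ℕ) : ℝ) < C * ((∏ i, x i * y i * z i : ℕ) : ℝ) ^ (1 + ε) :=
  stub_cruxZero_iff_levelFour.mp ((stub_normalForm.mp hU) 0)

/-- **Rounding off `S` only lowers the bracket**: `∏_{p ∣ m, p ∉ S} p^⌈v_p(m)/4⌉ ≤ ∏_{p ∣ m, p ∉ S} p^{v_p(m)}`
(`⌈v/4⌉ ≤ v`), hence `M_S(m) ≤ (∏_{p∈S} p) · {m}^S`. [folklore] -/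
theorem normalForm_mixed_le_sfree (S : Finset ℕ) (m : ℕ) :
    (∏ p ∈ S, p) * ∏ p ∈ m.primeFactors \ S, p ^ ((m.factorization p + 3) / 4) ≤
      (∏ p ∈ S, p) * ∏ p ∈ m.primeFactors \ S, p ^ m.factorization p := by
  refine Nat.mul_le_mul_left _ (Finset.prod_le_prod' fun p hp => ?_)
  refine Nat.pow_le_pow_right (Nat.pos_of_mem_primeFactors (Finset.mem_sdiff.mp hp).1) ?_
  omega

/-- **Crux at budget `K` ⟹ level-one rung at budget `K`.** The normal form at `K` implies "uniform
Mahler–Ridout with linear `S`-loss" at `K`: `c < C · ((∏_{p∈S} p) · {abc}^S)^(1+ε)` for every abc triple and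
every set `S` of at most `K` primes, `{m}^S = ∏_{p ∣ m, p ∉ S} p^{v_p(m)}` the `S`-free part (same `C`;
`normalForm_mixed_le_sfree` and monotonicity of `t ↦ C·t^(1+ε)`). [folklore] -/
theorem stub_levelOneRung_of_mixed (K : ℕ)
    (hM : ∀ ε : ℝ, 0 < ε → ∃ C : ℝ, 0 < C ∧ ∀ S : Finset ℕ, S.card ≤ K → (∀ p ∈ S, Nat.Prime p) →
        ∀ a b c : ℕ, IsABCTriple a b c →
          (c : ℝ) < C * ((((∏ p ∈ S, p) *
            ∏ p ∈ (a * b * c).primeFactors \ S, p ^ (((a * b * c).factorization p + 3) / 4) : ℕ) : ℝ)) ^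
              (1 + ε)) :
    ∀ ε : ℝ, 0 < ε → ∃ C : ℝ, 0 < C ∧ ∀ S : Finset ℕ, S.card ≤ K → (∀ p ∈ S, Nat.Prime p) →
      ∀ a b c : ℕ, IsABCTriple a b c →
        (c : ℝ) < C * ((((∏ p ∈ S, p) *
          ∏ p ∈ (a * b * c).primeFactors \ S, p ^ (a * b * c).factorization p : ℕ) : ℝ)) ^ (1 + ε) := by
  intro ε hε
  obtain ⟨C, hC, hK⟩ := hM ε hε
  refine ⟨C, hC, fun S hcard hS a b c habc => ?_⟩
  have hle : ((((∏ p ∈ S, p) *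
      ∏ p ∈ (a * b * c).primeFactors \ S, p ^ (((a * b * c).factorization p + 3) / 4) : ℕ) : ℝ)) ≤
      (((∏ p ∈ S, p) * ∏ p ∈ (a * b * c).primeFactors \ S, p ^ (a * b * c).factorization p : ℕ) : ℝ) := by
    exact_mod_cast normalForm_mixed_le_sfree S (a * b * c)
  calc (c : ℝ) < C * ((((∏ p ∈ S, p) *
        ∏ p ∈ (a * b * c).primeFactors \ S, p ^ (((a * b * c).factorization p + 3) / 4) : ℕ) : ℝ)) ^
          (1 + ε) := hK S hcard hS a b c habc
    _ ≤ C * ((((∏ p ∈ S, p) *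
        ∏ p ∈ (a * b * c).primeFactors \ S, p ^ (a * b * c).factorization p : ℕ) : ℝ)) ^ (1 + ε) := by
      gcongr

/-- **The crux implies the level-one rung at every budget**: `UniformSadicTowerFour ⟹` for every `K`,
`ε > 0` there is `C` with `c < C · ((∏_{p∈S} p) · {abc}^S)^(1+ε)` for every abc triple and every set `S` of
at most `K` primes. At `K = 2` this already contains Hall's inequality for prime arguments
(`stub_primeHall_of_levelOneTwo`). [folklore] -/
theorem levelOneRung_of_uniformSadicTowerFour (hU : UniformSadicTowerFour) (K : ℕ) :
    ∀ ε : ℝ, 0 < ε → ∃ C : ℝ, 0 < C ∧ ∀ S : Finset ℕ, S.card ≤ K → (∀ p ∈ S, Nat.Prime p) →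
      ∀ a b c : ℕ, IsABCTriple a b c →
        (c : ℝ) < C * ((((∏ p ∈ S, p) *
          ∏ p ∈ (a * b * c).primeFactors \ S, p ^ (a * b * c).factorization p : ℕ) : ℝ)) ^ (1 + ε) :=
  stub_levelOneRung_of_mixed K ((stub_normalForm.mp hU) K)

end Summit.ABC.ABC.Theorems.UniformSadicTowerFour.MixedRadical

end
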